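/-
Copyright (c) 2026 the pub-hodgecm-mathlib formalisation cell (harness21).  Prover seat hodgecm-mathlib-F0P3a-p07 (g14): «S3-ram» seeding wave (LEAD F0P3a-plan (g12∕g13);
owner F0P3a-p06 (g15)), (T2) G-side organ (Cnt2′), ROW SOCKET (bd) closed over F0P3a-p08 (g19)'s ★ p847623; 2026-09-02.
-/
import Literature.NumberTheory.Rogawski1990.DepthZeroKappaTransferTypeTwoRamifiedStratumBd        -- ★ p847623 (F0P3a-p08 (g19)): `ncard_rankStratum_two_typeTwo_ram_eq_ite`
import Literature.NumberTheory.Rogawski1990.DepthZeroKappaTransferTypeTwoRamifiedGSideNhdsEven    -- ★ p847470: brings the socket vocabulary (frame binders, `redMat`, `cmLocalIntegralLevel`, …)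
import Literature.NumberTheory.Automorphic.UnitaryLatticeTreeCharpolyCongruence                   -- ★ `v_inv_mul_charpoly_coeff_sub_le_one`
import Literature.NumberTheory.Automorphic.ValuedFieldValuativeRelBridge                         -- ★ `v_lt_one_iff_valuation_lt_one`
import Literature.NumberTheory.Rogawski1990.FinExplicitTransferFactorDeepTauTame                  -- ★ `toPlace_heckeUniformizer_ne_zero`, `valued_toPlace_heckeUniformizer_pow_lt_one`
import HarnessLib

/-!
# (Cnt2′) ROW SOCKET (bd), both parities: `stub_T2G_bd_{even,odd}_ram` of F0P3a-p07 (g14)'s skeleton v1 are THEOREMS over ★ p847623 (Rogawski 1990 Prop. 4.9.1, Lemma 4.9.3)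

Topic `NumberTheory/Rogawski1990`; namespace `Literature.NumberTheory.Rogawski1990`.  THEOREMS ONLY (no definition, no instance, no notation, no named fact, no `sorry`); kernel lane
`--supports stmt-HodgeConjecture-24833`.  Cell `pub/hodgecm-mathlib`, crux H413; road «S3-ram» (count-neutral).  The (Cnt2′) skeleton v1 (HOME `F0/P3a/F0P3a-p07/g14/cnt2/`,
5de24998∕78e2b613) proves the fold v7.7 sockets `stub_typeTwo_counts_{even,odd}_ram` over four ROW SOCKETS; this file discharges the first, (bd), in both parities, with
EXACTLY the socket texts (so the skeleton's `stub_T2G_bd_{even,odd}_ram := by exact typeTwo_stratumBd_{even,odd}_ram …`), by a ≤ 40-line adapter over F0P3a-p08 (g19)'s ★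
`ncard_rankStratum_two_typeTwo_ram_eq_ite` (ref5 (g5) R-353): (i) the socket's entrywise v-deep token ⇒ the head's charpoly-deep token (§1, ★ `v_inv_mul_charpoly_coeff_sub_le_one`
at `c := ι_w ϖ_v`, `B := 1`); (ii) `N := 2n` ∕ `2n+1`, the `Odd N` branch, the ℕ → ℂ cast and the exponent arithmetic `(2n+2m−2)∕2 = n+m−1`, `(2n+2m)∕2 = n+m`.
HONEST LABEL: HC_CM is proved only modulo the 2 remaining named inputs (hLiu418 24832, h413 24833) until rung 0 closes; bookkeeping over ★ organs, no books consequence.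

## References
* [Rogawski1990] J. D. Rogawski, *Automorphic Representations of Unitary Groups in Three Variables*, Ann. of Math. Stud. 123 (1990), §4.9 Prop. 4.9.1 (a)(b) p. 55, Lemma 4.9.3 p. 56.
* [Kottwitz1986] R. E. Kottwitz, *Base change for unit elements of Hecke algebras*, Compositio Math. 60 (1986), §3.
* [Lang2002] S. Lang, *Algebra*, GTM 211 (2002), Ch. XIV §3 (characteristic polynomial under reduction).
-/

set_option autoImplicit false

noncomputable section

open MeasureTheory Measure Set Filter Topology NumberField IsDedekindDomain Matrix Polynomial ValuativeRel
open Literature.NumberTheory.Automorphic Literature.NumberTheory.Automorphic.UnitaryGroup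
open Literature.NumberTheory.Automorphic.IntegralReduction Literature.NumberTheory.GaloisRepresentations
open Literature.NumberTheory.NumberFields Literature.NumberTheory.QuadraticForms
open Literature.GroupTheory.SpecificGroups Literature.NumberTheory.Automorphic.UnitaryLatticeTree
open scoped Matrix MatrixGroups ValuativeRel WithZero

namespace Literature.NumberTheory.Rogawski1990

/-! ## §1 The v-deep token implies the charpoly-deep token -/

/-- **ENTRYWISE v-DEEP ⇒ CHARPOLY-DEEP**: if `(ι_w ϖ_v)⁻¹·(t_w − 1)` is integral then every coefficient of `charpoly(t_w) − (X − 1)³` has valuation `< 1` (reduction mod `ι_w ϖ_v` commutes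
with `charpoly`, ★ `v_inv_mul_charpoly_coeff_sub_le_one`; `charpoly 1 = (X−1)³`; `|ι_w ϖ_v| < 1`). [cite: Lang2002, Ch. XIV §3 p. 561] [cite: Kottwitz1986, §3] -/
theorem forall_valuation_charpoly_sub_coeff_lt_one_of_vDeep (L : Type) [Field L] [NumberField L] [IsCMField L] (H' : Matrix (Fin 3) (Fin 3) L)
    {v : HeightOneSpectrum (𝓞 ↥(maximalRealSubfield L))} (w : PlacesOver L v) (t : (cmDatum L 3 H').Local v)
    (htdeep : ∀ a b, Valued.v (((toPlace v w (HeckeCharacter.uniformizer ↥(maximalRealSubfield L) v : v.adicCompletion ↥(maximalRealSubfield L))) ^ 1)⁻¹ *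
      ((((t).val : GL (Fin 3) (UnitaryGroup.LocalRing L v)).val.map (Pi.evalRingHom (fun w' : PlacesOver L v => w'.1.adicCompletion L) w)) a b -
        (1 : Matrix (Fin 3) (Fin 3) (w.1.adicCompletion L)) a b)) ≤ 1) :
    ∀ k : ℕ, ValuativeRel.valuation (w.1.adicCompletion L)
      ((((t.val : GL (Fin 3) (LocalRing L v)).val.map (Pi.evalRingHom (fun w' : PlacesOver L v => w'.1.adicCompletion L) w)).charpoly - (Polynomial.X - 1) ^ 3).coeff k) < 1 := by
  intro k
  set P : w.1.adicCompletion L := toPlace v w (HeckeCharacter.uniformizer ↥(maximalRealSubfield L) v : v.adicCompletion ↥(maximalRealSubfield L)) with hP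
  set T : Matrix (Fin 3) (Fin 3) (w.1.adicCompletion L) := ((t.val : GL (Fin 3) (LocalRing L v)).val.map (Pi.evalRingHom (fun w' : PlacesOver L v => w'.1.adicCompletion L) w)) with hT
  have hP1 : Valued.v P < 1 := by
    have h := valued_toPlace_heckeUniformizer_pow_lt_one L v w (le_refl 1)
    rwa [pow_one] at h
  have hPne : P ≠ 0 := toPlace_heckeUniformizer_ne_zero L v w
  have h1int : IsIntMatrix (1 : Matrix (Fin 3) (Fin 3) (w.1.adicCompletion L)) := fun a b => by
    rw [Matrix.one_apply]; split_ifs <;> simp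
  have hDint : IsIntMatrix (P⁻¹ • (T - 1)) := fun a b => by
    rw [Matrix.smul_apply, smul_eq_mul, Matrix.sub_apply]
    have h := htdeep a b
    rwa [pow_one] at h
  have hc := v_inv_mul_charpoly_coeff_sub_le_one h1int hP1.le hDint k
  rw [Matrix.charpoly_one, Fintype.card_fin] at hc
  rw [Polynomial.coeff_sub, ← v_lt_one_iff_valuation_lt_one]
  have hmul : Valued.v (T.charpoly.coeff k - ((Polynomial.X - 1) ^ 3 : Polynomial (w.1.adicCompletion L)).coeff k) =
      Valued.v P * Valued.v (P⁻¹ * (T.charpoly.coeff k - ((Polynomial.X - 1) ^ 3 : Polynomial (w.1.adicCompletion L)).coeff k)) := by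
    rw [← map_mul, ← mul_assoc, mul_inv_cancel₀ hPne, one_mul]
  rw [hmul]
  calc Valued.v P * _ ≤ Valued.v P * 1 := mul_le_mul' le_rfl hc
    _ < 1 := by rw [mul_one]; exact hP1

/-! ## §2 The (bd) row sockets, both parities -/

set_option maxHeartbeats 1600000 in
/-- **ROW SOCKET (bd), Even depth** — EXACTLY the type of `stub_T2G_bd_even_ram` of the (Cnt2′) skeleton v1: per literal `δ`, `n_bd(δ) = q^m·X̃_bd(n)` if `κ(δ) = 1 ↔ FAV(γH)`, else `0`;
from ★ `ncard_rankStratum_two_typeTwo_ram_eq_ite` at `N := 2 * n` with the charpoly-deep token of §1. [cite: Rogawski1990, §4.9 Prop. 4.9.1 (a) p. 55, Lemma 4.9.3 p. 56] [cite: Kottwitz1986, §3] -/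
theorem typeTwo_stratumBd_even_ram
    (L : Type) [Field L] [NumberField L] [IsCMField L] (H' : Matrix (Fin 3) (Fin 3) L)
    {v : HeightOneSpectrum (𝓞 ↥(maximalRealSubfield L))}
    (hH' : (H'.map (cmConjRingHom L)).transpose = H') (w : PlacesOver L v)
    (hw : IsCMField.complexConj L • w.1 = w.1) (he : v.asIdeal.ramificationIdx' w.1.asIdeal ≠ 1)
    (hH'w : IsUnit (placeForm H' w.1)) (hH'i : hH'w.unit ∈ glInt 3 (w.1.adicCompletion L))
    (h2 : IsUnit (2 : 𝒪[(w.1.adicCompletion L)]))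
    (ϖ : w.1.adicCompletion L) (_hϖ : Valued.v ϖ = WithZero.exp (-1 : ℤ)) (_hσϖ : galAdicCompletionMap (L := L) (IsCMField.complexConj L) hw ϖ = -ϖ)
    (A : GL (Fin 3) (w.1.adicCompletion L)) (_hA : A ∈ glInt 3 (w.1.adicCompletion L))
    (_hframe : placeForm H' w.1 = (-(placeForm H' w.1).det) • formCongr (galAdicCompletionMap (L := L) (IsCMField.complexConj L) hw) A ((StdForm.antidiagonal 3).over (w.1.adicCompletion L))) :
    ∀ ⦃γH : ((cmDatum L 2 (Matrix.of fun i j : Fin 2 => if i.val + j.val + 1 = 2 then (1 : L) else 0)).Local v × (cmDatum L 1 (Matrix.of fun i j : Fin 1 => if i.val + j.val + 1 = 1 then (1 : L) else 0)).Local v)⦄,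
      (∀ i j : Fin 2, Valued.v (((((γH.1.val : GL (Fin 2) (UnitaryGroup.LocalRing L v)).val.map (Pi.evalRingHom (fun w' : PlacesOver L v => w'.1.adicCompletion L) w))) - 1) i j) ≤ Valued.v (ϖ ^ 2)) → Valued.v (finGammaTwo L v γH w - 1) ≤ Valued.v (ϖ ^ 2) → IsLocalGRegular L v γH →
      (¬ ∃ x : (w.1.adicCompletion L), ((((γH.1.val : GL (Fin 2) (UnitaryGroup.LocalRing L v)).val.map (Pi.evalRingHom (fun w' : PlacesOver L v => w'.1.adicCompletion L) w))).charpoly).IsRoot x) → ∀ ⦃n : ℕ⦄,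
      Valued.v ((((γH.1.val : GL (Fin 2) (UnitaryGroup.LocalRing L v)).val.map (Pi.evalRingHom (fun w' : PlacesOver L v => w'.1.adicCompletion L) w))).trace ^ 2 - 4 * (((γH.1.val : GL (Fin 2) (UnitaryGroup.LocalRing L v)).val.map (Pi.evalRingHom (fun w' : PlacesOver L v => w'.1.adicCompletion L) w))).det) = WithZero.exp (-((2 * (2 * n) : ℕ) : ℤ)) → 1 ≤ n →
      ∀ (m : ℕ), Valued.v (((finCharpolyTwo L v γH).eval (finGammaTwo L v γH)) w) =
          Valued.v ((toPlace v w (HeckeCharacter.uniformizer ↥(maximalRealSubfield L) v : v.adicCompletion ↥(maximalRealSubfield L))) ^ m) →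
        ∀ δ : ((cmDatum L 3 H').Local v), IsLocalNormPair L H' v γH δ → (finKappaAt L v H' γH δ = 1 ∨ finKappaAt L v H' γH δ = -1) →
        (∀ a b, Valued.v (((toPlace v w (HeckeCharacter.uniformizer ↥(maximalRealSubfield L) v : v.adicCompletion ↥(maximalRealSubfield L))) ^ 1)⁻¹ * ((((δ).val : GL (Fin 3) (UnitaryGroup.LocalRing L v)).val.map (Pi.evalRingHom (fun w' : PlacesOver L v => w'.1.adicCompletion L) w)) a b - (1 : Matrix (Fin 3) (Fin 3) (w.1.adicCompletion L)) a b)) ≤ 1) →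
        (((finKappaAt L v H' γH δ = 1 ↔ (∃ z : (w.1.adicCompletion L), z * galAdicCompletionMap (L := L) (IsCMField.complexConj L) hw z *
          ((placeForm H' w.1).det * ((finCharpolyTwo L v γH).eval (finGammaTwo L v γH)) w /
            ((1 + finGammaTwo L v γH w) ^ 2 * (1 + ((γH.1.val.val : Matrix (Fin 2) (Fin 2) (LocalRing L v)).map (Pi.evalRingHom (fun w' : PlacesOver L v => w'.1.adicCompletion L) w)).trace + ((γH.1.val.val : Matrix (Fin 2) (Fin 2) (LocalRing L v)).map (Pi.evalRingHom (fun w' : PlacesOver L v => w'.1.adicCompletion L) w)).det))) = 1)) →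
          ({q : (((cmDatum L 3 H').Local v) ⧸ cmLocalIntegralLevel L 3 H' v) | q ∈ MulAction.fixedBy (((cmDatum L 3 H').Local v) ⧸ cmLocalIntegralLevel L 3 H' v) δ ∧ (redMat (((((q.out⁻¹ * δ * q.out)).val : GL (Fin 3) (UnitaryGroup.LocalRing L v)).val.map (Pi.evalRingHom (fun w' : PlacesOver L v => w'.1.adicCompletion L) w))) - 1).rank = 2}.ncard : ℂ) = (Ideal.absNorm v.asIdeal : ℂ) ^ m * (((Ideal.absNorm v.asIdeal : ℂ) + 1) * (Ideal.absNorm v.asIdeal : ℂ) ^ n / (Ideal.absNorm v.asIdeal : ℂ))) ∧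
        (¬ (finKappaAt L v H' γH δ = 1 ↔ (∃ z : (w.1.adicCompletion L), z * galAdicCompletionMap (L := L) (IsCMField.complexConj L) hw z *
          ((placeForm H' w.1).det * ((finCharpolyTwo L v γH).eval (finGammaTwo L v γH)) w /
            ((1 + finGammaTwo L v γH w) ^ 2 * (1 + ((γH.1.val.val : Matrix (Fin 2) (Fin 2) (LocalRing L v)).map (Pi.evalRingHom (fun w' : PlacesOver L v => w'.1.adicCompletion L) w)).trace + ((γH.1.val.val : Matrix (Fin 2) (Fin 2) (LocalRing L v)).map (Pi.evalRingHom (fun w' : PlacesOver L v => w'.1.adicCompletion L) w)).det))) = 1)) →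
          ({q : (((cmDatum L 3 H').Local v) ⧸ cmLocalIntegralLevel L 3 H' v) | q ∈ MulAction.fixedBy (((cmDatum L 3 H').Local v) ⧸ cmLocalIntegralLevel L 3 H' v) δ ∧ (redMat (((((q.out⁻¹ * δ * q.out)).val : GL (Fin 3) (UnitaryGroup.LocalRing L v)).val.map (Pi.evalRingHom (fun w' : PlacesOver L v => w'.1.adicCompletion L) w))) - 1).rank = 2}.ncard : ℂ) = 0)) := by
  intro γH _hblk _hu hreg hirr n hN hn1 m hm δ hδ _hκ hdeep
  have ht := forall_valuation_charpoly_sub_coeff_lt_one_of_vDeep L H' w δ hdeep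
  have h := ncard_rankStratum_two_typeTwo_ram_eq_ite L H' hH' w hw he hH'w hH'i h2 hreg hirr m (2 * n) hm hN (by omega) hδ ht
  have hq0 : (Ideal.absNorm v.asIdeal : ℂ) ≠ 0 := by
    have h0 : Ideal.absNorm v.asIdeal ≠ 0 := by rw [Ne, Ideal.absNorm_eq_zero_iff]; exact v.ne_bot
    exact_mod_cast h0
  refine ⟨fun hf => ?_, fun hf => ?_⟩
  · rw [if_pos hf] at h
    rw [if_neg (by simp)] at h
    have hexp : (2 * n + 2 * m - 2) / 2 = n + m - 1 := by omega
    rw [hexp] at h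
    rw [h]
    push_cast
    have hnm : n + m - 1 + 1 = n + m := by omega
    have hp : (Ideal.absNorm v.asIdeal : ℂ) ^ (n + m - 1) * (Ideal.absNorm v.asIdeal : ℂ) = (Ideal.absNorm v.asIdeal : ℂ) ^ m * (Ideal.absNorm v.asIdeal : ℂ) ^ n := by rw [← pow_succ, hnm, pow_add, mul_comm]
    have hp' : (Ideal.absNorm v.asIdeal : ℂ) ^ (n + m - 1) = (Ideal.absNorm v.asIdeal : ℂ) ^ m * (Ideal.absNorm v.asIdeal : ℂ) ^ n / (Ideal.absNorm v.asIdeal : ℂ) := by rw [eq_div_iff hq0]; exact hp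
    rw [hp']; ring
  · rw [if_neg hf] at h
    rw [h]
    push_cast
    rfl

set_option maxHeartbeats 1600000 in
/-- **ROW SOCKET (bd), Odd depth** — EXACTLY the type of `stub_T2G_bd_odd_ram` of the (Cnt2′) skeleton v1: per literal `δ`, `n_bd(δ) = q^m·X̃_bd(n)` if `κ(δ) = 1 ↔ FAV(γH)`, else `0`;
from ★ `ncard_rankStratum_two_typeTwo_ram_eq_ite` at `N := 2 * n + 1` with the charpoly-deep token of §1. [cite: Rogawski1990, §4.9 Prop. 4.9.1 (a) p. 55, Lemma 4.9.3 p. 56] [cite: Kottwitz1986, §3] -/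
theorem typeTwo_stratumBd_odd_ram
    (L : Type) [Field L] [NumberField L] [IsCMField L] (H' : Matrix (Fin 3) (Fin 3) L)
    {v : HeightOneSpectrum (𝓞 ↥(maximalRealSubfield L))}
    (hH' : (H'.map (cmConjRingHom L)).transpose = H') (w : PlacesOver L v)
    (hw : IsCMField.complexConj L • w.1 = w.1) (he : v.asIdeal.ramificationIdx' w.1.asIdeal ≠ 1)
    (hH'w : IsUnit (placeForm H' w.1)) (hH'i : hH'w.unit ∈ glInt 3 (w.1.adicCompletion L))
    (h2 : IsUnit (2 : 𝒪[(w.1.adicCompletion L)]))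
    (ϖ : w.1.adicCompletion L) (_hϖ : Valued.v ϖ = WithZero.exp (-1 : ℤ)) (_hσϖ : galAdicCompletionMap (L := L) (IsCMField.complexConj L) hw ϖ = -ϖ)
    (A : GL (Fin 3) (w.1.adicCompletion L)) (_hA : A ∈ glInt 3 (w.1.adicCompletion L))
    (_hframe : placeForm H' w.1 = (-(placeForm H' w.1).det) • formCongr (galAdicCompletionMap (L := L) (IsCMField.complexConj L) hw) A ((StdForm.antidiagonal 3).over (w.1.adicCompletion L))) :
    ∀ ⦃γH : ((cmDatum L 2 (Matrix.of fun i j : Fin 2 => if i.val + j.val + 1 = 2 then (1 : L) else 0)).Local v × (cmDatum L 1 (Matrix.of fun i j : Fin 1 => if i.val + j.val + 1 = 1 then (1 : L) else 0)).Local v)⦄,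
      (∀ i j : Fin 2, Valued.v (((((γH.1.val : GL (Fin 2) (UnitaryGroup.LocalRing L v)).val.map (Pi.evalRingHom (fun w' : PlacesOver L v => w'.1.adicCompletion L) w))) - 1) i j) ≤ Valued.v (ϖ ^ 2)) → Valued.v (finGammaTwo L v γH w - 1) ≤ Valued.v (ϖ ^ 2) → IsLocalGRegular L v γH →
      (¬ ∃ x : (w.1.adicCompletion L), ((((γH.1.val : GL (Fin 2) (UnitaryGroup.LocalRing L v)).val.map (Pi.evalRingHom (fun w' : PlacesOver L v => w'.1.adicCompletion L) w))).charpoly).IsRoot x) → ∀ ⦃n : ℕ⦄,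
      Valued.v ((((γH.1.val : GL (Fin 2) (UnitaryGroup.LocalRing L v)).val.map (Pi.evalRingHom (fun w' : PlacesOver L v => w'.1.adicCompletion L) w))).trace ^ 2 - 4 * (((γH.1.val : GL (Fin 2) (UnitaryGroup.LocalRing L v)).val.map (Pi.evalRingHom (fun w' : PlacesOver L v => w'.1.adicCompletion L) w))).det) = WithZero.exp (-((2 * (2 * n + 1) : ℕ) : ℤ)) → 1 ≤ n →
      ∀ (m : ℕ), Valued.v (((finCharpolyTwo L v γH).eval (finGammaTwo L v γH)) w) =
          Valued.v ((toPlace v w (HeckeCharacter.uniformizer ↥(maximalRealSubfield L) v : v.adicCompletion ↥(maximalRealSubfield L))) ^ m) →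
        ∀ δ : ((cmDatum L 3 H').Local v), IsLocalNormPair L H' v γH δ → (finKappaAt L v H' γH δ = 1 ∨ finKappaAt L v H' γH δ = -1) →
        (∀ a b, Valued.v (((toPlace v w (HeckeCharacter.uniformizer ↥(maximalRealSubfield L) v : v.adicCompletion ↥(maximalRealSubfield L))) ^ 1)⁻¹ * ((((δ).val : GL (Fin 3) (UnitaryGroup.LocalRing L v)).val.map (Pi.evalRingHom (fun w' : PlacesOver L v => w'.1.adicCompletion L) w)) a b - (1 : Matrix (Fin 3) (Fin 3) (w.1.adicCompletion L)) a b)) ≤ 1) →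
        (((finKappaAt L v H' γH δ = 1 ↔ (∃ z : (w.1.adicCompletion L), z * galAdicCompletionMap (L := L) (IsCMField.complexConj L) hw z *
          ((placeForm H' w.1).det * ((finCharpolyTwo L v γH).eval (finGammaTwo L v γH)) w /
            ((1 + finGammaTwo L v γH w) ^ 2 * (1 + ((γH.1.val.val : Matrix (Fin 2) (Fin 2) (LocalRing L v)).map (Pi.evalRingHom (fun w' : PlacesOver L v => w'.1.adicCompletion L) w)).trace + ((γH.1.val.val : Matrix (Fin 2) (Fin 2) (LocalRing L v)).map (Pi.evalRingHom (fun w' : PlacesOver L v => w'.1.adicCompletion L) w)).det))) = 1)) →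
          ({q : (((cmDatum L 3 H').Local v) ⧸ cmLocalIntegralLevel L 3 H' v) | q ∈ MulAction.fixedBy (((cmDatum L 3 H').Local v) ⧸ cmLocalIntegralLevel L 3 H' v) δ ∧ (redMat (((((q.out⁻¹ * δ * q.out)).val : GL (Fin 3) (UnitaryGroup.LocalRing L v)).val.map (Pi.evalRingHom (fun w' : PlacesOver L v => w'.1.adicCompletion L) w))) - 1).rank = 2}.ncard : ℂ) = (Ideal.absNorm v.asIdeal : ℂ) ^ m * (2 * (Ideal.absNorm v.asIdeal : ℂ) ^ n)) ∧
        (¬ (finKappaAt L v H' γH δ = 1 ↔ (∃ z : (w.1.adicCompletion L), z * galAdicCompletionMap (L := L) (IsCMField.complexConj L) hw z *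
          ((placeForm H' w.1).det * ((finCharpolyTwo L v γH).eval (finGammaTwo L v γH)) w /
            ((1 + finGammaTwo L v γH w) ^ 2 * (1 + ((γH.1.val.val : Matrix (Fin 2) (Fin 2) (LocalRing L v)).map (Pi.evalRingHom (fun w' : PlacesOver L v => w'.1.adicCompletion L) w)).trace + ((γH.1.val.val : Matrix (Fin 2) (Fin 2) (LocalRing L v)).map (Pi.evalRingHom (fun w' : PlacesOver L v => w'.1.adicCompletion L) w)).det))) = 1)) →
          ({q : (((cmDatum L 3 H').Local v) ⧸ cmLocalIntegralLevel L 3 H' v) | q ∈ MulAction.fixedBy (((cmDatum L 3 H').Local v) ⧸ cmLocalIntegralLevel L 3 H' v) δ ∧ (redMat (((((q.out⁻¹ * δ * q.out)).val : GL (Fin 3) (UnitaryGroup.LocalRing L v)).val.map (Pi.evalRingHom (fun w' : PlacesOver L v => w'.1.adicCompletion L) w))) - 1).rank = 2}.ncard : ℂ) = 0)) := by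
  intro γH _hblk _hu hreg hirr n hN hn1 m hm δ hδ _hκ hdeep
  have ht := forall_valuation_charpoly_sub_coeff_lt_one_of_vDeep L H' w δ hdeep
  have h := ncard_rankStratum_two_typeTwo_ram_eq_ite L H' hH' w hw he hH'w hH'i h2 hreg hirr m (2 * n + 1) hm hN (by omega) hδ ht
  have hq0 : (Ideal.absNorm v.asIdeal : ℂ) ≠ 0 := by
    have h0 : Ideal.absNorm v.asIdeal ≠ 0 := by rw [Ne, Ideal.absNorm_eq_zero_iff]; exact v.ne_bot
    exact_mod_cast h0
  refine ⟨fun hf => ?_, fun hf => ?_⟩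
  · rw [if_pos hf] at h
    rw [if_pos (by simp)] at h
    have hexp : (2 * n + 1 + 2 * m - 1) / 2 = n + m := by omega
    rw [hexp] at h
    rw [h]
    push_cast
    
    rw [pow_add]; ring
  · rw [if_neg hf] at h
    rw [h]
    push_cast
    rfl

end Literature.NumberTheory.Rogawski1990
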